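import Summits.ABC.ABC.Theses.IneffectiveSubspace

/-!
# `TowerFourSubLiouville` (stmt-ABC-1649): enemies of the core REPEL — the gap principle, kernel-checked

Negative-side structure theorem (standing disprover, cycle 7, refuter-cdisprove-stmt-ABC-1649-g7-0) for the
crux-equivalent core of the crux (`Summit.ABC.ABC.Theorems.TowerFourSubLiouville.stub_coreIffCrux`, p87895):
a uniform saving `η > 0` in `|wZ⁴ − vY⁴| > Z^η` for coprime `vY⁴ ≠ wZ⁴` with `max(v,w) ≤ Z^η`.  A would-be
counterexample family of the crux is a family of VIOLATORS `(v, w, Y, Z)`: `|wZ⁴ − vY⁴| ≤ Z^η`.  This file proves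
the elementary, fully uniform and effective constraint on two violators OF THE SAME FORM `(v, w)`:

* `twoSolution_identity` — `a₁Z₂⁴ − a₂Z₁⁴ = v·(Y₂Z₁ − Y₁Z₂)(Y₂Z₁ + Y₁Z₂)((Y₂Z₁)² + (Y₁Z₂)²)` for
  `aᵢ = wZᵢ⁴ − vYᵢ⁴` (any commutative ring);
* `enemies_repel_core` — hence, if `Y₁Z₂ ≠ Y₂Z₁`: `v·Y₁³·Z₂³ ≤ |a₁|·Z₂⁴ + |a₂|·Z₁⁴` (no hypothesis at all on
  sizes: the cross-difference is a nonzero integer);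
* `ubq_violators_repel` — **two distinct coprime violators of one form with `2 ≤ Z₁ ≤ Z₂` satisfy
  `Z₁³ < 4·Z₂^{1+η}`** (`0 ≤ η ≤ 2`, `v, w ≥ 1`), i.e. `Z₂ > (Z₁³/4)^{1/(1+η)}`: for the crux-relevant
  `η → 0` the next violator of a form lies beyond the CUBE of the previous one, at `η = 1` beyond `Z₁^{3/2}/2`,
  and only at the per-form endpoint `η = 2` (where Dirichlet supplies violators, `Negative.FixedFormsDirichlet`)
  does the constraint become void — consistent with the per-form dial being exactly `2`.

READING FOR THE DISPROOF / FOR PROVERS.  Per form, violators are super-lacunary: `log Z_{k+1} ≥ (3/(1+η))·log Z_k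
− log 4`, so a form has `≤ log log T / log(3/(1+η)) + O(1)` violators up to height `T`, uniformly and effectively
— COUNTING violators is free (this is the elementary shadow of the Thue–Siegel / Bombieri–Schmidt / Evertse /
Bennett counting theorems quoted in `Lines/fourth-radical-binomial-thue-dead.md`), while the crux asks that there
be NONE beyond `Z₀` once `max(v,w) ≤ Z^η`: the entire content of the crux is the FIRST large violator of each
form, about which repulsion says nothing.  Conversely an enemy family of the crux (tower quality `→ 2`) must
change its form `(v, w)` essentially at every step (by Roth each form carries finitely many violators for `η < 2`,
`stub_fixedFormsRoth`, p85914; by this file, consecutive ones are cubically spaced).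

No `sorry`; axioms standard; imports only the route file (for the namespace conventions).  [folklore: the
gap principle for Thue inequalities, e.g. Bombieri–Schmidt 1987 §2; here in integer form, without real roots]
-/

-- `Summit.ABC.ABC` is the mandated summit-side namespace (CONVENTIONS §2); the duplicate is deliberate.
set_option linter.dupNamespace false

namespace Summit.ABC.ABC.Theorems.TowerFourSubLiouville.Negative

/-- **The two-solution identity.** For `aᵢ = wZᵢ⁴ − vYᵢ⁴`:
`a₁Z₂⁴ − a₂Z₁⁴ = v (Y₂Z₁ − Y₁Z₂)(Y₂Z₁ + Y₁Z₂)((Y₂Z₁)² + (Y₁Z₂)²)` (`= v((Y₂Z₁)⁴ − (Y₁Z₂)⁴)`). -/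
theorem twoSolution_identity {R : Type*} [CommRing R] (v w Y₁ Z₁ Y₂ Z₂ : R) :
    (w * Z₁ ^ 4 - v * Y₁ ^ 4) * Z₂ ^ 4 - (w * Z₂ ^ 4 - v * Y₂ ^ 4) * Z₁ ^ 4 =
      v * ((Y₂ * Z₁ - Y₁ * Z₂) * ((Y₂ * Z₁ + Y₁ * Z₂) * ((Y₂ * Z₁) ^ 2 + (Y₁ * Z₂) ^ 2))) := by
  ring

/-- **Gap principle, integer core.** If `Y₁Z₂ ≠ Y₂Z₁` then
`v·Y₁³·Z₂³ ≤ |wZ₁⁴ − vY₁⁴|·Z₂⁴ + |wZ₂⁴ − vY₂⁴|·Z₁⁴`: the cross-difference `Y₂Z₁ − Y₁Z₂` is a nonzero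
integer, so the right side of `twoSolution_identity` is at least `v · 1 · (Y₁Z₂) · (Y₁Z₂)²` in absolute value,
while the left side is at most `|a₁|Z₂⁴ + |a₂|Z₁⁴`. -/
theorem enemies_repel_core {v w Y₁ Z₁ Y₂ Z₂ : ℕ} (hne : Y₁ * Z₂ ≠ Y₂ * Z₁) :
    (v : ℝ) * (Y₁ : ℝ) ^ 3 * (Z₂ : ℝ) ^ 3 ≤
      |(w : ℝ) * (Z₁ : ℝ) ^ 4 - v * (Y₁ : ℝ) ^ 4| * (Z₂ : ℝ) ^ 4 +
        |(w : ℝ) * (Z₂ : ℝ) ^ 4 - v * (Y₂ : ℝ) ^ 4| * (Z₁ : ℝ) ^ 4 := by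
  have hD : (1 : ℝ) ≤ |(Y₂ : ℝ) * Z₁ - Y₁ * Z₂| := by
    have hne' : ((Y₂ * Z₁ : ℕ) : ℤ) - ((Y₁ * Z₂ : ℕ) : ℤ) ≠ 0 := by
      intro h
      apply hne
      have h' : ((Y₂ * Z₁ : ℕ) : ℤ) = ((Y₁ * Z₂ : ℕ) : ℤ) := by linarith
      exact (Nat.cast_injective h').symm
    have h1 : (1 : ℤ) ≤ |((Y₂ * Z₁ : ℕ) : ℤ) - ((Y₁ * Z₂ : ℕ) : ℤ)| := Int.one_le_abs hne'
    have h2 : ((1 : ℤ) : ℝ) ≤ ((|((Y₂ * Z₁ : ℕ) : ℤ) - ((Y₁ * Z₂ : ℕ) : ℤ)| : ℤ) : ℝ) := by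
      exact_mod_cast h1
    have h3 : ((|((Y₂ * Z₁ : ℕ) : ℤ) - ((Y₁ * Z₂ : ℕ) : ℤ)| : ℤ) : ℝ) = |(Y₂ : ℝ) * Z₁ - Y₁ * Z₂| := by
      push_cast; ring_nf
    rw [h3] at h2
    exact_mod_cast h2
  have hid := twoSolution_identity (v : ℝ) (w : ℝ) (Y₁ : ℝ) (Z₁ : ℝ) (Y₂ : ℝ) (Z₂ : ℝ)
  have hS : (Y₁ : ℝ) * Z₂ ≤ (Y₂ : ℝ) * Z₁ + Y₁ * Z₂ := by
    have : (0 : ℝ) ≤ (Y₂ : ℝ) * Z₁ := by positivity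
    linarith
  have hQ : ((Y₁ : ℝ) * Z₂) ^ 2 ≤ ((Y₂ : ℝ) * Z₁) ^ 2 + ((Y₁ : ℝ) * Z₂) ^ 2 := by
    have : (0 : ℝ) ≤ ((Y₂ : ℝ) * Z₁) ^ 2 := by positivity
    linarith
  have hT : (0 : ℝ) ≤ ((Y₂ : ℝ) * Z₁ + Y₁ * Z₂) * (((Y₂ : ℝ) * Z₁) ^ 2 + ((Y₁ : ℝ) * Z₂) ^ 2) := by
    positivity
  calc (v : ℝ) * (Y₁ : ℝ) ^ 3 * (Z₂ : ℝ) ^ 3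
      = (v : ℝ) * (1 * (((Y₁ : ℝ) * Z₂) * ((Y₁ : ℝ) * Z₂) ^ 2)) := by ring
    _ ≤ (v : ℝ) * (|(Y₂ : ℝ) * Z₁ - Y₁ * Z₂| *
          (((Y₂ : ℝ) * Z₁ + Y₁ * Z₂) * (((Y₂ : ℝ) * Z₁) ^ 2 + ((Y₁ : ℝ) * Z₂) ^ 2))) := by
        apply mul_le_mul_of_nonneg_left _ (by positivity)
        exact mul_le_mul hD (mul_le_mul hS hQ (by positivity) (by positivity)) (by positivity)
          (abs_nonneg _)
    _ = |(v : ℝ) * (((Y₂ : ℝ) * Z₁ - Y₁ * Z₂) *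
          (((Y₂ : ℝ) * Z₁ + Y₁ * Z₂) * (((Y₂ : ℝ) * Z₁) ^ 2 + ((Y₁ : ℝ) * Z₂) ^ 2)))| := by
        rw [abs_mul, abs_mul, Nat.abs_cast, abs_of_nonneg hT]
    _ = |((w : ℝ) * (Z₁ : ℝ) ^ 4 - v * (Y₁ : ℝ) ^ 4) * (Z₂ : ℝ) ^ 4 -
          ((w : ℝ) * (Z₂ : ℝ) ^ 4 - v * (Y₂ : ℝ) ^ 4) * (Z₁ : ℝ) ^ 4| := by rw [hid]
    _ ≤ |((w : ℝ) * (Z₁ : ℝ) ^ 4 - v * (Y₁ : ℝ) ^ 4) * (Z₂ : ℝ) ^ 4| +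
          |((w : ℝ) * (Z₂ : ℝ) ^ 4 - v * (Y₂ : ℝ) ^ 4) * (Z₁ : ℝ) ^ 4| := abs_sub _ _
    _ = |(w : ℝ) * (Z₁ : ℝ) ^ 4 - v * (Y₁ : ℝ) ^ 4| * (Z₂ : ℝ) ^ 4 +
          |(w : ℝ) * (Z₂ : ℝ) ^ 4 - v * (Y₂ : ℝ) ^ 4| * (Z₁ : ℝ) ^ 4 := by
        rw [abs_mul, abs_mul, abs_of_nonneg (by positivity : (0 : ℝ) ≤ (Z₂ : ℝ) ^ 4),
          abs_of_nonneg (by positivity : (0 : ℝ) ≤ (Z₁ : ℝ) ^ 4)]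

/-- **Repulsion in the saving regime.** Two solutions of the same form `(v, w)` (`v, w ≥ 1`) with
`|wZᵢ⁴ − vYᵢ⁴| ≤ Zᵢ^η` (`0 ≤ η ≤ 2`), `2 ≤ Z₁ ≤ Z₂` and `Y₁Z₂ ≠ Y₂Z₁` satisfy `Z₁³ < 4·Z₂^{1+η}`.
Proof: the core gives `vY₁³Z₂³ ≤ 2Z₂^{4+η}`, i.e. `vY₁³ ≤ 2Z₂^{1+η}`; and `vY₁⁴ ≥ wZ₁⁴ − Z₁^η ≥ Z₁⁴ − Z₁²
≥ Z₁⁴/2`, so `(vY₁³)⁴ ≥ (vY₁⁴)³ ≥ Z₁¹²/8`; hence `Z₁¹² ≤ 128·Z₂^{4(1+η)} < (4Z₂^{1+η})⁴`. -/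
theorem enemies_repel {η : ℝ} (hη0 : 0 ≤ η) (hη2 : η ≤ 2) {v w Y₁ Z₁ Y₂ Z₂ : ℕ} (hv : 0 < v)
    (hw : 0 < w) (hZ₁ : 2 ≤ Z₁) (hle : Z₁ ≤ Z₂) (hne : Y₁ * Z₂ ≠ Y₂ * Z₁)
    (ha₁ : |(w : ℝ) * (Z₁ : ℝ) ^ 4 - v * (Y₁ : ℝ) ^ 4| ≤ (Z₁ : ℝ) ^ η)
    (ha₂ : |(w : ℝ) * (Z₂ : ℝ) ^ 4 - v * (Y₂ : ℝ) ^ 4| ≤ (Z₂ : ℝ) ^ η) :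
    (Z₁ : ℝ) ^ 3 < 4 * (Z₂ : ℝ) ^ (1 + η) := by
  have core := enemies_repel_core (v := v) (w := w) hne
  have hZ1R : (2 : ℝ) ≤ Z₁ := by exact_mod_cast hZ₁
  have hZ12 : (Z₁ : ℝ) ≤ Z₂ := by exact_mod_cast hle
  have hZ1pos : (0 : ℝ) < Z₁ := by linarith
  have hZ2pos : (0 : ℝ) < Z₂ := by linarith
  have hη4 : (0 : ℝ) ≤ (Z₂ : ℝ) ^ η := Real.rpow_nonneg hZ2pos.le _
  have hZ1η : (Z₁ : ℝ) ^ η ≤ (Z₂ : ℝ) ^ η := Real.rpow_le_rpow hZ1pos.le hZ12 hη0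
  -- upper bound `v Y₁³ ≤ 2 Z₂^{1+η}`
  have hup : (v : ℝ) * (Y₁ : ℝ) ^ 3 * (Z₂ : ℝ) ^ 3 ≤ 2 * (Z₂ : ℝ) ^ η * (Z₂ : ℝ) ^ 4 := by
    have h1 : |(w : ℝ) * (Z₁ : ℝ) ^ 4 - v * (Y₁ : ℝ) ^ 4| * (Z₂ : ℝ) ^ 4 ≤ (Z₂ : ℝ) ^ η * (Z₂ : ℝ) ^ 4 :=
      mul_le_mul_of_nonneg_right (ha₁.trans hZ1η) (by positivity)
    have h2 : |(w : ℝ) * (Z₂ : ℝ) ^ 4 - v * (Y₂ : ℝ) ^ 4| * (Z₁ : ℝ) ^ 4 ≤ (Z₂ : ℝ) ^ η * (Z₂ : ℝ) ^ 4 :=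
      mul_le_mul ha₂ (pow_le_pow_left₀ hZ1pos.le hZ12 4) (by positivity) hη4
    linarith
  have hup' : (v : ℝ) * (Y₁ : ℝ) ^ 3 ≤ 2 * (Z₂ : ℝ) ^ (1 + η) := by
    have h : (v : ℝ) * (Y₁ : ℝ) ^ 3 * (Z₂ : ℝ) ^ 3 ≤ (2 * (Z₂ : ℝ) ^ (1 + η)) * (Z₂ : ℝ) ^ 3 :=
      calc _ ≤ 2 * (Z₂ : ℝ) ^ η * (Z₂ : ℝ) ^ 4 := hup
        _ = (2 * (Z₂ : ℝ) ^ (1 + η)) * (Z₂ : ℝ) ^ 3 := by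
            rw [Real.rpow_add hZ2pos, Real.rpow_one]; ring
    exact le_of_mul_le_mul_right h (by positivity)
  -- lower bound `Z₁⁴ / 2 ≤ v Y₁⁴`
  have hlow4 : (Z₁ : ℝ) ^ 4 / 2 ≤ (v : ℝ) * (Y₁ : ℝ) ^ 4 := by
    have h1 : (w : ℝ) * (Z₁ : ℝ) ^ 4 - v * (Y₁ : ℝ) ^ 4 ≤ (Z₁ : ℝ) ^ η := (le_abs_self _).trans ha₁
    have hw1 : (1 : ℝ) ≤ w := by exact_mod_cast hw
    have h2 : (Z₁ : ℝ) ^ 4 ≤ (w : ℝ) * (Z₁ : ℝ) ^ 4 := le_mul_of_one_le_left (by positivity) hw1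
    have h3 : (Z₁ : ℝ) ^ η ≤ (Z₁ : ℝ) ^ 2 := by
      have h := Real.rpow_le_rpow_of_exponent_le (by linarith : (1 : ℝ) ≤ Z₁) hη2
      rwa [Real.rpow_two] at h
    have h4 : 2 * (Z₁ : ℝ) ^ 2 ≤ (Z₁ : ℝ) ^ 4 := by
      have h22 : (2 : ℝ) ≤ (Z₁ : ℝ) ^ 2 := by nlinarith
      nlinarith
    linarith
  have hv1 : (1 : ℝ) ≤ v := by exact_mod_cast hv
  have hlow : ((Z₁ : ℝ) ^ 4 / 2) ^ 3 ≤ ((v : ℝ) * (Y₁ : ℝ) ^ 3) ^ 4 :=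
    calc ((Z₁ : ℝ) ^ 4 / 2) ^ 3 ≤ ((v : ℝ) * (Y₁ : ℝ) ^ 4) ^ 3 := pow_le_pow_left₀ (by positivity) hlow4 3
      _ ≤ ((v : ℝ) * (Y₁ : ℝ) ^ 4) ^ 3 * v := le_mul_of_one_le_right (by positivity) hv1
      _ = ((v : ℝ) * (Y₁ : ℝ) ^ 3) ^ 4 := by ring
  -- combine
  have hcomb : ((Z₁ : ℝ) ^ 3) ^ 4 < (4 * (Z₂ : ℝ) ^ (1 + η)) ^ 4 := by
    have h1 : ((v : ℝ) * (Y₁ : ℝ) ^ 3) ^ 4 ≤ (2 * (Z₂ : ℝ) ^ (1 + η)) ^ 4 :=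
      pow_le_pow_left₀ (by positivity) hup' 4
    have hpos : (0 : ℝ) < ((Z₂ : ℝ) ^ (1 + η)) ^ 4 := by positivity
    calc ((Z₁ : ℝ) ^ 3) ^ 4 = 8 * ((Z₁ : ℝ) ^ 4 / 2) ^ 3 := by ring
      _ ≤ 8 * (2 * (Z₂ : ℝ) ^ (1 + η)) ^ 4 := by linarith [hlow.trans h1]
      _ = 128 * ((Z₂ : ℝ) ^ (1 + η)) ^ 4 := by ring
      _ < 256 * ((Z₂ : ℝ) ^ (1 + η)) ^ 4 := by linarith
      _ = (4 * (Z₂ : ℝ) ^ (1 + η)) ^ 4 := by ring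
  exact lt_of_pow_lt_pow_left₀ 4 (by positivity) hcomb

/-- Distinct REDUCED pairs have nonzero cross-difference: if `gcd(vY₁, wZ₁) = 1 = gcd(vY₂, wZ₂)` (so
`gcd(Yᵢ, Zᵢ) = 1`), `Z₁ ≥ 1` and `(Y₁, Z₁) ≠ (Y₂, Z₂)`, then `Y₁Z₂ ≠ Y₂Z₁`. -/
theorem cross_ne_of_coprime {v w Y₁ Z₁ Y₂ Z₂ : ℕ} (hZ₁ : 0 < Z₁)
    (h₁ : Nat.Coprime (v * Y₁) (w * Z₁)) (h₂ : Nat.Coprime (v * Y₂) (w * Z₂))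
    (hne : (Y₁, Z₁) ≠ (Y₂, Z₂)) : Y₁ * Z₂ ≠ Y₂ * Z₁ := by
  intro h
  have c1 : Nat.Coprime Y₁ Z₁ :=
    Nat.Coprime.coprime_dvd_left ⟨v, by ring⟩ (Nat.Coprime.coprime_dvd_right ⟨w, by ring⟩ h₁)
  have c2 : Nat.Coprime Y₂ Z₂ :=
    Nat.Coprime.coprime_dvd_left ⟨v, by ring⟩ (Nat.Coprime.coprime_dvd_right ⟨w, by ring⟩ h₂)
  have d1 : Z₁ ∣ Z₂ := c1.symm.dvd_of_dvd_mul_right ⟨Y₂, by rw [mul_comm Z₂ Y₁, h]; ring⟩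
  have d2 : Z₂ ∣ Z₁ := c2.symm.dvd_of_dvd_mul_right ⟨Y₁, by rw [mul_comm Z₁ Y₂, ← h]; ring⟩
  have hZ : Z₁ = Z₂ := Nat.dvd_antisymm d1 d2
  rw [← hZ] at h
  have hY : Y₁ = Y₂ := Nat.eq_of_mul_eq_mul_right hZ₁ h
  exact hne (by rw [hY, hZ])

/-- **Violators of the core repel (registered cast conventions).** Two DISTINCT coprime solutions of the same
form `(v, w)`, `v, w ≥ 1`, with `|wZᵢ⁴ − vYᵢ⁴| ≤ Zᵢ^η` (`0 ≤ η ≤ 2`) and `2 ≤ Z₁ ≤ Z₂` satisfy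
`Z₁³ < 4·Z₂^{1+η}`.  Iterating: the `k`-th violator of a form has `log Z_k ≥ (3/(1+η))^{k−1}(log Z₁ − log 4 …)`,
so a form has `O_η(log log T)` violators up to `T` — counting is free; the crux is the FIRST one. -/
theorem ubq_violators_repel {η : ℝ} (hη0 : 0 ≤ η) (hη2 : η ≤ 2) {v w Y₁ Z₁ Y₂ Z₂ : ℕ}
    (hv : 0 < v) (hw : 0 < w) (hZ₁ : 2 ≤ Z₁) (hle : Z₁ ≤ Z₂) (hne : (Y₁, Z₁) ≠ (Y₂, Z₂))
    (hc₁ : Nat.Coprime (v * Y₁) (w * Z₁)) (hc₂ : Nat.Coprime (v * Y₂) (w * Z₂))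
    (ha₁ : |((w * Z₁ ^ 4 : ℕ) : ℝ) - ((v * Y₁ ^ 4 : ℕ) : ℝ)| ≤ (Z₁ : ℝ) ^ η)
    (ha₂ : |((w * Z₂ ^ 4 : ℕ) : ℝ) - ((v * Y₂ ^ 4 : ℕ) : ℝ)| ≤ (Z₂ : ℝ) ^ η) :
    (Z₁ : ℝ) ^ 3 < 4 * (Z₂ : ℝ) ^ (1 + η) := by
  push_cast at ha₁ ha₂
  exact enemies_repel hη0 hη2 hv hw hZ₁ hle (cross_ne_of_coprime (by omega) hc₁ hc₂ hne) ha₁ ha₂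

end Summit.ABC.ABC.Theorems.TowerFourSubLiouville.Negative
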